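import Literature.Geometry.Riemannian.ColdingMinicozziEntropy

/-!
# Colding–Minicozzi entropy: invariance under isometries and dilations; planes have entropy one

Proved properties of `gaussianArea` / `gaussianEntropy` (`ColdingMinicozziEntropy.lean`), all
stated by Colding–Minicozzi 2012 (p. 760: "`λ` is nonnegative and invariant under dilations,
rotations, or translations of `Σ`"; (1.8): "`F_{0,α²t₀}(αΣ) = F_{0,t₀}(Σ)`"; Remark 1.7: "the
density was defined so that it is one on a hyperplane"):

* `gaussianArea_image_isometryEquiv`, `gaussianEntropy_image_isometryEquiv`,
  `gaussianEntropy_vadd` — invariance under isometries `g : E ≃ᵢ F` (in particular rigid motions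
  and translations), from the isometry invariance of Mathlib's `μHE[n]`;
* `setLIntegral_smul_set_euclideanHausdorffMeasure` (change of variables
  `∫_{cA} f dμHE[n] = |c|ⁿ ∫_A f(c·) dμHE[n]`), `gaussianArea_smul`
  (`F_{cp,c²t}(cA) = F_{p,t}(A)`), `gaussianEntropy_smul` (`λ(cA) = λ(A)`, `c ≠ 0`);
* `lintegral_gaussianWeight_zero` (`∫_V e^{-‖v‖²/4t} dv = (4πt)^{dim V/2}`, Mathlib's Gaussian
  integral), `gaussianArea_affineSubspace_of_mem` (`F_{p,t}(P) = 1` for `p ∈ P`),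
  `gaussianArea_affineSubspace` (`F_{p,t}(P) = e^{-dist(p,P)²/4t}` via Pythagoras and the
  orthogonal projection), `gaussianArea_affineSubspace_le_one`, and
  `gaussianEntropy_affineSubspace`: **`λ(P) = 1` for every nonempty affine subspace `P` with
  `dim P = n`** (CM 2012 Remark 1.7; CIMW 2013 "`1 = λ(ℝⁿ)`").

No named facts; imports only `ColdingMinicozziEntropy.lean` (hence `Mathlib`, `HarnessLib`).

## References

* T. H. Colding, W. P. Minicozzi II, *Generic mean curvature flow I; generic singularities*,
  Ann. of Math. 175 (2012) 755–833: p. 760, Remark 1.7, (1.8), Lemma 7.2. [ColdingMinicozzi2012]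
* T. H. Colding, T. Ilmanen, W. P. Minicozzi II, B. White, *The round sphere minimizes entropy
  among closed self-shrinkers*, J. Differential Geom. 95 (2013) 53–69, Introduction.
  [ColdingIlmanenMinicozziWhite2013]
-/

noncomputable section

open MeasureTheory MeasureTheory.Measure Set
open scoped ENNReal NNReal Topology Pointwise RealInnerProductSpace

namespace Literature.Geometry.Riemannian

/-! ### Invariance under isometries -/

section Isometry

variable {E : Type*} [NormedAddCommGroup E] [MeasurableSpace E] [BorelSpace E]
variable {F : Type*} [NormedAddCommGroup F] [MeasurableSpace F] [BorelSpace F]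

omit [MeasurableSpace E] [BorelSpace E] [MeasurableSpace F] [BorelSpace F] in
/-- The Gaussian weight is invariant under isometries: `w_{g p,t}(g x) = w_{p,t}(x)`. [folklore] -/
theorem gaussianWeight_isometryEquiv (g : E ≃ᵢ F) (p : E) (t : ℝ) (x : E) :
    gaussianWeight (g p) t (g x) = gaussianWeight p t x := by
  simp only [gaussianWeight, ← dist_eq_norm, g.dist_eq]

/-- **Isometry invariance of the Gaussian area**: `F_{g p,t}(g A) = F_{p,t}(A)` for an isometry
`g` (Colding–Minicozzi 2012, p. 760: invariance under rotations and translations; `μHE[n]` is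
isometry-invariant). [cite: ColdingMinicozzi2012, p. 760] -/
theorem gaussianArea_image_isometryEquiv (g : E ≃ᵢ F) (n : ℕ) (p : E) (t : ℝ) (A : Set E) :
    gaussianArea n (g p) t (g '' A) = gaussianArea n p t A := by
  have hge : MeasurableEmbedding g := g.toHomeomorph.measurableEmbedding
  rw [gaussianArea_eq, gaussianArea_eq,
    ← (g.measurePreserving_euclideanHausdorffMeasure n).setLIntegral_comp_emb hge]
  simp only [gaussianWeight_isometryEquiv]

/-- **Isometry invariance of the entropy**: `λ(g A) = λ(A)` for an isometry `g : E ≃ᵢ F`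
(Colding–Minicozzi 2012, p. 760: "`λ` is … invariant under dilations, rotations, or translations
of `Σ`"). [cite: ColdingMinicozzi2012, p. 760] -/
theorem gaussianEntropy_image_isometryEquiv (g : E ≃ᵢ F) (n : ℕ) (A : Set E) :
    gaussianEntropy n (g '' A) = gaussianEntropy n A := by
  rw [gaussianEntropy_eq_iSup, gaussianEntropy_eq_iSup, ← g.surjective.iSup_comp]
  simp only [gaussianArea_image_isometryEquiv]

/-- Translation invariance of the entropy: `λ(v + A) = λ(A)`. [cite: ColdingMinicozzi2012, p. 760] -/
theorem gaussianEntropy_vadd (n : ℕ) (v : E) (A : Set E) :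
    gaussianEntropy n (v +ᵥ A) = gaussianEntropy n A := by
  have h : (IsometryEquiv.addLeft v) '' A = v +ᵥ A := by
    ext x
    simp only [Set.mem_image, IsometryEquiv.addLeft_apply, Set.mem_vadd_set, vadd_eq_add]
  rw [← h, gaussianEntropy_image_isometryEquiv]

end Isometry

/-! ### Invariance under dilations -/

section Dilation

variable {E : Type*} [NormedAddCommGroup E] [NormedSpace ℝ E] [MeasurableSpace E] [BorelSpace E]

omit [MeasurableSpace E] [BorelSpace E] in
/-- The Gaussian weight under a dilation: `w_{c p, c² t}(c x) = w_{p,t}(x)` for `c ≠ 0`.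
[folklore] -/
theorem gaussianWeight_smul {c : ℝ} (hc : c ≠ 0) (p : E) (t : ℝ) (x : E) :
    gaussianWeight (c • p) (c ^ 2 * t) (c • x) = gaussianWeight p t x := by
  unfold gaussianWeight
  congr 2
  rw [← smul_sub, norm_smul, mul_pow, Real.norm_eq_abs, sq_abs,
    show (4 : ℝ) * (c ^ 2 * t) = c ^ 2 * (4 * t) by ring, neg_mul_eq_mul_neg,
    mul_div_mul_left _ _ (pow_ne_zero 2 hc)]

/-- **Change of variables for `μHE[n]` under a dilation**:
`∫_{c • A} f dμHE[n] = |c|ⁿ ∫_A f(c • y) dμHE[n](y)` for `c ≠ 0` (from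
`μHE[n](c • s) = |c|ⁿ μHE[n](s)`, Mathlib `euclideanHausdorffMeasure_smul₀`). [folklore] -/
theorem setLIntegral_smul_set_euclideanHausdorffMeasure {c : ℝ} (hc : c ≠ 0) (n : ℕ)
    (f : E → ℝ≥0∞) (A : Set E) :
    ∫⁻ x in c • A, f x ∂(μHE[n] : Measure E) =
      (‖c‖₊ : ℝ≥0∞) ^ n * ∫⁻ y in A, f (c • y) ∂(μHE[n] : Measure E) := by
  set T : E ≃ᵐ E := (Homeomorph.smulOfNeZero c hc).toMeasurableEquiv with hT
  have hTc : (T : E → E) = fun x => c • x := rfl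
  have hK0 : ((‖c‖₊ : ℝ≥0∞) ^ n) ≠ 0 :=
    pow_ne_zero _ (ENNReal.coe_ne_zero.2 (nnnorm_ne_zero_iff.2 hc))
  have hKtop : ((‖c‖₊ : ℝ≥0∞) ^ n) ≠ ∞ := ENNReal.pow_ne_top ENNReal.coe_ne_top
  have hmap : (μHE[n] : Measure E).map T = ((‖c‖₊ : ℝ≥0∞) ^ n)⁻¹ • (μHE[n] : Measure E) := by
    ext s hs
    rw [Measure.map_apply T.measurable hs, Measure.smul_apply, smul_eq_mul, hTc,
      Set.preimage_smul₀ hc, euclideanHausdorffMeasure_smul₀ n (inv_ne_zero hc), ENNReal.smul_def,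
      smul_eq_mul, nnnorm_inv, inv_pow, ENNReal.coe_inv (pow_ne_zero _ (nnnorm_ne_zero_iff.2 hc)),
      ENNReal.coe_pow]
  have hsub : ∫⁻ x in c • A, f x ∂((μHE[n] : Measure E).map T) =
      ∫⁻ y in A, f (c • y) ∂(μHE[n] : Measure E) := by
    rw [MeasurableEquiv.restrict_map, MeasureTheory.lintegral_map_equiv]
    simp only [hTc, Set.preimage_smul₀ hc, inv_smul_smul₀ hc]
  rw [← hsub, hmap, Measure.restrict_smul, lintegral_smul_measure, smul_eq_mul, ← mul_assoc,
    ENNReal.mul_inv_cancel hK0 hKtop, one_mul]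

/-- **Dilation invariance of the Gaussian area**: `F_{c p, c² t}(c A) = F_{p,t}(A)` for `c ≠ 0`,
`t > 0` (Colding–Minicozzi 2012, (1.8): "`F_{0,α²t₀}(αΣ) = F_{0,t₀}(Σ)` … similarly for
rescalings about an arbitrary `x₀`"). [cite: ColdingMinicozzi2012, (1.8)] -/
theorem gaussianArea_smul {c : ℝ} (hc : c ≠ 0) (n : ℕ) (p : E) {t : ℝ} (ht : 0 < t) (A : Set E) :
    gaussianArea n (c • p) (c ^ 2 * t) (c • A) = gaussianArea n p t A := by
  have hK0 : ((‖c‖₊ : ℝ≥0∞) ^ n) ≠ 0 :=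
    pow_ne_zero _ (ENNReal.coe_ne_zero.2 (nnnorm_ne_zero_iff.2 hc))
  have hKtop : ((‖c‖₊ : ℝ≥0∞) ^ n) ≠ ∞ := ENNReal.pow_ne_top ENNReal.coe_ne_top
  rw [gaussianArea_eq, gaussianArea_eq, setLIntegral_smul_set_euclideanHausdorffMeasure hc]
  simp only [gaussianWeight_smul hc]
  rw [← mul_assoc]
  congr 1
  have hpos : 0 < 4 * Real.pi * t := by positivity
  have hsplit : (4 * Real.pi * (c ^ 2 * t)) ^ (-(n : ℝ) / 2) =
      (|c| ^ n)⁻¹ * (4 * Real.pi * t) ^ (-(n : ℝ) / 2) := by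
    rw [show 4 * Real.pi * (c ^ 2 * t) = c ^ 2 * (4 * Real.pi * t) by ring,
      Real.mul_rpow (sq_nonneg c) hpos.le]
    congr 1
    rw [← sq_abs, ← Real.rpow_natCast |c| 2, ← Real.rpow_mul (abs_nonneg c),
      show ((2 : ℕ) : ℝ) * (-(n : ℝ) / 2) = -(n : ℝ) by push_cast; ring,
      Real.rpow_neg (abs_nonneg c), Real.rpow_natCast]
  unfold gaussianNormalization
  rw [hsplit, ENNReal.ofReal_mul (by positivity), ENNReal.ofReal_inv_of_pos (by positivity),
    ENNReal.ofReal_pow (abs_nonneg c), ← Real.norm_eq_abs, ofReal_norm, enorm_eq_nnnorm,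
    mul_comm ((‖c‖₊ : ℝ≥0∞) ^ n)⁻¹, mul_assoc, ENNReal.inv_mul_cancel hK0 hKtop, mul_one]

/-- **Dilation invariance of the entropy**: `λ(c A) = λ(A)` for `c ≠ 0` (Colding–Minicozzi 2012,
p. 760: "`λ` is nonnegative and invariant under dilations, rotations, or translations of `Σ`").
[cite: ColdingMinicozzi2012, p. 760] -/
theorem gaussianEntropy_smul {c : ℝ} (hc : c ≠ 0) (n : ℕ) (A : Set E) :
    gaussianEntropy n (c • A) = gaussianEntropy n A := by
  simp only [gaussianEntropy_eq_iSup]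
  refine le_antisymm (iSup_le fun p => iSup_le fun t => iSup_le fun ht => ?_)
    (iSup_le fun p => iSup_le fun t => iSup_le fun ht => ?_)
  · have h := gaussianArea_smul hc n (c⁻¹ • p) (t := t / c ^ 2) (by positivity) A
    rw [smul_inv_smul₀ hc, show c ^ 2 * (t / c ^ 2) = t by field_simp] at h
    rw [h]
    exact gaussianArea_le_gaussianEntropy n _ (by positivity) A
  · rw [← gaussianArea_smul hc n p ht A]
    exact gaussianArea_le_gaussianEntropy n _ (by positivity) _

end Dilation

/-! ### Planes have entropy one -/

section Plane

/-- The Gaussian integral behind the normalisation: on a finite-dimensional real inner product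
space `V` of dimension `d`, `∫_V exp(-‖v‖²/(4t)) dv = (4πt)^{d/2}` for `t > 0` (Mathlib's
`GaussianFourier.integral_rexp_neg_mul_sq_norm`). [folklore] -/
theorem lintegral_gaussianWeight_zero {V : Type*} [NormedAddCommGroup V] [InnerProductSpace ℝ V]
    [FiniteDimensional ℝ V] [MeasurableSpace V] [BorelSpace V] {t : ℝ} (ht : 0 < t) :
    ∫⁻ v, gaussianWeight (0 : V) t v =
      ENNReal.ofReal ((4 * Real.pi * t) ^ ((Module.finrank ℝ V : ℝ) / 2)) := by
  have hb : 0 < (4 * t)⁻¹ := by positivity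
  have hint : Integrable (fun v : V => Real.exp (-(4 * t)⁻¹ * ‖v‖ ^ 2)) := by
    have h := (GaussianFourier.integrable_cexp_neg_mul_sq_norm_add (V := V)
      (b := (((4 * t)⁻¹ : ℝ) : ℂ)) (by simpa using hb) 0 0).norm
    refine h.congr (ae_of_all _ fun v => ?_)
    have h1 : (-(((4 * t)⁻¹ : ℝ) : ℂ) * (‖v‖ : ℂ) ^ 2 + 0 * (⟪(0 : V), v⟫ : ℂ)) =
        ((-(4 * t)⁻¹ * ‖v‖ ^ 2 : ℝ) : ℂ) := by
      push_cast
      ring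
    simp only [h1, Complex.norm_exp, Complex.ofReal_re]
  have hw : ∀ v : V, gaussianWeight (0 : V) t v =
      ENNReal.ofReal (Real.exp (-(4 * t)⁻¹ * ‖v‖ ^ 2)) := by
    intro v
    simp only [gaussianWeight, sub_zero]
    congr 2
    ring
  simp_rw [hw]
  rw [← ofReal_integral_eq_lintegral_ofReal hint (ae_of_all _ fun v => (Real.exp_pos _).le),
    GaussianFourier.integral_rexp_neg_mul_sq_norm hb, div_inv_eq_mul,
    show Real.pi * (4 * t) = 4 * Real.pi * t by ring]

variable {E : Type*} [NormedAddCommGroup E] [InnerProductSpace ℝ E] [MeasurableSpace E]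
  [BorelSpace E]

/-- **An affine `n`-plane has Gaussian area `1` from any of its points**: for an affine subspace
`S` with `dim S = n`, `p ∈ S` and `t > 0`, `F_{p,t}(S) = (4πt)^{-n/2} ∫_S e^{-‖x-p‖²/4t} d𝓗ⁿ = 1`
(Colding–Minicozzi 2012, Remark 1.7: "the density was defined so that it is one on a
hyperplane"; proof of Lemma 7.2: the weight "is a heat kernel on a hyperplane through `x₀` and
has integral one on the hyperplane independent of `t₀`"). [cite: ColdingMinicozzi2012, Remark 1.7] -/
theorem gaussianArea_affineSubspace_of_mem {n : ℕ} (S : AffineSubspace ℝ E)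
    [FiniteDimensional ℝ S.direction] (hS : Module.finrank ℝ S.direction = n) {p : E}
    (hp : p ∈ S) {t : ℝ} (ht : 0 < t) : gaussianArea n p t (S : Set E) = 1 := by
  subst hS
  set f : S.direction → E := fun v => (v : E) + p with hf_def
  have hf : Isometry f := Isometry.of_dist_eq fun v w => by
    simp only [hf_def, dist_eq_norm, add_sub_add_right_eq_sub, ← Submodule.coe_sub,
      Submodule.coe_norm]
  have hrange : Set.range f = (S : Set E) := by
    ext x
    constructor
    · rintro ⟨v, rfl⟩
      simpa [hf_def, vadd_eq_add] using AffineSubspace.vadd_mem_of_mem_direction v.2 hp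
    · intro hx
      exact ⟨⟨x -ᵥ p, AffineSubspace.vsub_mem_direction hx hp⟩, by simp [hf_def]⟩
  rw [gaussianArea_eq, ← hrange, ← hf.map_euclideanHausdorffMeasure,
    lintegral_map (measurable_gaussianWeight p t) hf.continuous.measurable]
  have hw : ∀ v : S.direction, gaussianWeight p t (f v) = gaussianWeight (0 : S.direction) t v := by
    intro v
    simp [gaussianWeight, hf_def]
  simp_rw [hw]
  rw [InnerProductSpace.euclideanHausdorffMeasure_eq_volume, lintegral_gaussianWeight_zero ht,
    gaussianNormalization, ← ENNReal.ofReal_mul (Real.rpow_nonneg (by positivity) _),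
    ← Real.rpow_add (by positivity),
    show -(Module.finrank ℝ S.direction : ℝ) / 2 + (Module.finrank ℝ S.direction : ℝ) / 2 = 0 by
      ring,
    Real.rpow_zero, ENNReal.ofReal_one]

/-- **Gaussian area of an affine `n`-plane from an arbitrary centre**: `F_{p,t}(S) =
exp(-dist(p, π_S p)²/(4t))`, where `π_S` is the orthogonal projection onto `S` (Pythagoras:
`‖x - p‖² = ‖x - π_S p‖² + ‖p - π_S p‖²` for `x ∈ S`, and `F_{π_S p,t}(S) = 1`). [folklore] -/
theorem gaussianArea_affineSubspace {n : ℕ} (S : AffineSubspace ℝ E) [Nonempty S]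
    [FiniteDimensional ℝ S.direction] (hS : Module.finrank ℝ S.direction = n) (p : E) {t : ℝ}
    (ht : 0 < t) :
    gaussianArea n p t (S : Set E) =
      gaussianWeight (EuclideanGeometry.orthogonalProjection S p : E) t p := by
  set q : E := (EuclideanGeometry.orthogonalProjection S p : E) with hq
  have hqS : q ∈ S := (EuclideanGeometry.orthogonalProjection S p).2
  have hSmeas : MeasurableSet (S : Set E) := (AffineSubspace.closed_of_finiteDimensional S).measurableSet
  have hpyth : ∀ x ∈ (S : Set E),
      gaussianWeight p t x = gaussianWeight q t x * gaussianWeight q t p := by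
    intro x hx
    have h := EuclideanGeometry.dist_sq_eq_dist_orthogonalProjection_sq_add_dist_orthogonalProjection_sq
      (s := S) p hx
    simp only [gaussianWeight, ← ENNReal.ofReal_mul (Real.exp_pos _).le, ← Real.exp_add]
    congr 2
    rw [← dist_eq_norm, ← dist_eq_norm, ← dist_eq_norm, sq, sq, sq, h, ← hq]
    ring
  rw [gaussianArea_eq, setLIntegral_congr_fun hSmeas (fun x hx => hpyth x hx),
    lintegral_mul_const _ (measurable_gaussianWeight q t), ← mul_assoc, ← gaussianArea_eq,
    gaussianArea_affineSubspace_of_mem S hS hqS ht, one_mul]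

/-- The Gaussian area of an affine `n`-plane is at most `1` from every centre and scale.
[cite: ColdingMinicozzi2012, Remark 1.7] -/
theorem gaussianArea_affineSubspace_le_one {n : ℕ} (S : AffineSubspace ℝ E) [Nonempty S]
    [FiniteDimensional ℝ S.direction] (hS : Module.finrank ℝ S.direction = n) (p : E) {t : ℝ}
    (ht : 0 < t) : gaussianArea n p t (S : Set E) ≤ 1 := by
  rw [gaussianArea_affineSubspace S hS p ht]
  exact gaussianWeight_le_one _ ht.le _

/-- **Affine `n`-planes have entropy one**: `λ(S) = 1` for every nonempty affine subspace `S`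
with `dim S = n` (Colding–Minicozzi 2012, Remark 1.7; Colding–Ilmanen–Minicozzi–White 2013,
Introduction: "`… > 1 = λ(ℝⁿ)`"). With Mathlib's normalised `μHE[n]` this is a theorem, which pins
the normalisation of `gaussianArea`. [cite: ColdingMinicozzi2012, Remark 1.7] -/
theorem gaussianEntropy_affineSubspace {n : ℕ} (S : AffineSubspace ℝ E) [hne : Nonempty S]
    [FiniteDimensional ℝ S.direction] (hS : Module.finrank ℝ S.direction = n) :
    gaussianEntropy n (S : Set E) = 1 := by
  apply le_antisymm
  · exact iSup_le fun p => iSup_le fun t => iSup_le fun ht =>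
      gaussianArea_affineSubspace_le_one S hS p ht
  · obtain ⟨⟨p, hp⟩⟩ := hne
    calc (1 : ℝ≥0∞) = gaussianArea n p 1 (S : Set E) :=
          (gaussianArea_affineSubspace_of_mem S hS hp one_pos).symm
      _ ≤ gaussianEntropy n (S : Set E) := gaussianArea_le_gaussianEntropy n p one_pos _

end Plane

end Literature.Geometry.Riemannian
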